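import Mathlib
import Summits.ValiantsHypothesis.ValiantsHypothesis.Theorems.NewtonUnitEquationsDissociatedUniformTotalsLawSmoothPointwise
import HarnessLib

/-!
# Crux `NewtonUnitEquations.DissociatedUniform` (stmt-ValiantsHypothesis-5905): the POINTWISE question on the smooth stratum —
# typed forms, the refuted one and the located one (orientation dichotomy)

Memo `Cruxes/DissociatedUniform/NOTES-t1g8.md` §2–§3.  On the smooth stratum (three curves with convexly ordered hodographs) the
totals are `≤ 6q² + 6Z` (`…TotalsLawHodographFamilies`) and conjecturally `≤ 2q² + Cq` (`SmoothSharpTotalsLaw`).  This file types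
the two POINTWISE statements that the census of this generation separates:

* `SmoothClassBound C` — every class of a smooth configuration has `≤ C·q` hull vertices.  **FALSE for every `C ≤ 5`**
  (`not_smoothClassBound`, from the kernel witness `…TotalsLawSmoothPointwise.exists_smooth_fat_class`: `q = 11`, a class with `57`
  vertices), and expected false for every `C`: in the family "A regular, B a near-congruent rotated copy, C a huge CONTRA-oriented fan"
  one class carries `V_s = q + Σ_z #(normals of the fibre P_{s−z} inside the cone K_z of C) ≈ q²/2`
  (`0.55, 0.54, 0.53, 0.52, 0.52 · q²` at `q = 11, 13, 17, 23, 31`, exact hulls), while `T = 2q²` exactly.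
* `CoOrientedClassBound C` — the same pointwise bound for three convexly ordered, injective curves traversed IN THE SAME SENSE (all
  left- or all right-turning, the hypothesis of `…TotalsLawLeftTurning.unionVert_le_twelve_mul` for pairs).  LOCATED, OPEN:
  census `max_s V_s ≈ 2.4q` on the family above with a co-oriented fan, `≤ 2.7q` under structured and unstructured annealing
  (`q = 9, 11, 13`), and in the dominant-third-curve regime the best possible co-oriented cone assignment (a dynamic programme over
  all convex `C`) never exceeded `q + 2q` (`q = 11, 13, 17`, five families of pairs) — the mechanism being that for co-oriented
  triples the normal cones of `C` and the normal clusters of the fibres `P_{s−z}` counter-rotate in `z` and can lock only `O(1)`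
  times per lap.  The truth is believed to be `C = 3`.
* `totalVert_le_of_coOrientedClassBound` — the pointwise conjecture would give `T ≤ C q²` on the co-oriented smooth stratum
  (for `C < 6` an improvement of the landed constant there), and `coOrientedClassBound_mono`, `not_coOrientedClassBound_zero`.
Honest label: statement file with one refutation-by-import; `CoOrientedClassBound`, `SmoothSharpTotalsLaw`, `TotalsLawThree` are
OPEN and asserted nowhere; nothing here bears on VP ≠ VNP.
-/

set_option linter.dupNamespace false -- `ValiantsHypothesis.ValiantsHypothesis` (summit = problem) in every name

open scoped BigOperators

namespace Summit.ValiantsHypothesis.ValiantsHypothesis.Theorems.NewtonUnitEquationsDissociatedUniform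

namespace TotalsLaw

open Literature.Computability.AlgebraicComplexity.KPTT.PlanarMinkowski

/-- **Pointwise class bound on the smooth stratum** (typed only to be refuted: `not_smoothClassBound`): every class of three curves
with convexly ordered hodographs has at most `C·q` hull vertices. -/
def SmoothClassBound (C : ℕ) : Prop :=
  ∀ (q : ℕ) [NeZero q] (a b c : ZMod q → (Fin 2 → ℝ)), ConvexlyOrdered (edgeVec a) → ConvexlyOrdered (edgeVec b) →
    ConvexlyOrdered (edgeVec c) → ∀ s, classVert a b c s ≤ C * q

/-- **Pointwise class bound for CO-ORIENTED smooth triples** (conjecture-grade, OPEN; census `C = 3`): three convexly ordered,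
injective curves over `ℤ/q`, all left-turning or all right-turning, have every class hull of size `≤ C·q`.  The contra-oriented
analogue is false (`not_smoothClassBound`).  Not asserted anywhere. -/
@[conjecture] def CoOrientedClassBound (C : ℕ) : Prop :=
  ∀ (q : ℕ) [NeZero q] (a b c : ZMod q → (Fin 2 → ℝ)), ConvexlyOrdered a → ConvexlyOrdered b → ConvexlyOrdered c →
    Function.Injective a → Function.Injective b → Function.Injective c →
    (LeftTurning a ∧ LeftTurning b ∧ LeftTurning c) ∨ (RightTurning a ∧ RightTurning b ∧ RightTurning c) →
    ∀ s, classVert a b c s ≤ C * q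

/-- **The smooth pointwise bound is false for every `C ≤ 5`** (kernel witness at `q = 11` with a class of `57` vertices). -/
theorem not_smoothClassBound {C : ℕ} (hC : C ≤ 5) : ¬ SmoothClassBound C := by
  intro h
  obtain ⟨a, b, c, -, -, -, -, -, -, ha, hb, hc, -, -, -, hV⟩ := exists_smooth_fat_class
  have h11 := h 11 a b c ha hb hc 0
  have : C * 11 ≤ 55 := by omega
  omega

/-- Monotonicity of the located conjecture in its constant. -/
theorem coOrientedClassBound_mono {C C' : ℕ} (hCC' : C ≤ C') (h : CoOrientedClassBound C) : CoOrientedClassBound C' := by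
  intro q _ a b c ha hb hc hai hbi hci hturn s
  exact (h q a b c ha hb hc hai hbi hci hturn s).trans (Nat.mul_le_mul_right _ hCC')

/-- **Pointwise ⇒ totals** on the co-oriented smooth stratum: `CoOrientedClassBound C` gives `T ≤ C·q²` there (for `C < 6` this
would improve the landed hodograph-convex constant on that sub-stratum). -/
theorem totalVert_le_of_coOrientedClassBound {C : ℕ} (h : CoOrientedClassBound C) {q : ℕ} [NeZero q]
    (a b c : ZMod q → (Fin 2 → ℝ)) (ha : ConvexlyOrdered a) (hb : ConvexlyOrdered b) (hc : ConvexlyOrdered c)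
    (hai : Function.Injective a) (hbi : Function.Injective b) (hci : Function.Injective c)
    (hturn : (LeftTurning a ∧ LeftTurning b ∧ LeftTurning c) ∨ (RightTurning a ∧ RightTurning b ∧ RightTurning c)) :
    totalVert a b c ≤ C * q ^ 2 := by
  unfold totalVert
  calc ∑ s, classVert a b c s ≤ ∑ _s : ZMod q, C * q :=
        Finset.sum_le_sum fun s _ => h q a b c ha hb hc hai hbi hci hturn s
    _ = C * q ^ 2 := by rw [Finset.sum_const, Finset.card_univ, ZMod.card, smul_eq_mul]; ring

/-- The co-oriented conjecture with `C = 0` is false (a class is nonempty, so it has a hull vertex): a sanity floor showing the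
hypotheses are satisfiable, witnessed by the co-oriented `q = 11` curves `A11`, `B11`, `A11` of `…TotalsLawSmoothPointwise`. -/
theorem not_coOrientedClassBound_zero : ¬ CoOrientedClassBound 0 := by
  classical
  intro h
  have hq : 3 ≤ 11 := by norm_num
  obtain ⟨hA, hB, -⟩ := injective_witness
  have h0 := h 11 (intCurve A11) (intCurve B11) (intCurve A11)
    (convexlyOrdered_of_strictlyConvexCcw strictlyConvexCcw_A11 hq) (convexlyOrdered_of_strictlyConvexCcw strictlyConvexCcw_B11 hq)
    (convexlyOrdered_of_strictlyConvexCcw strictlyConvexCcw_A11 hq) hA hB hA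
    (Or.inl ⟨leftTurning_of_strictlyConvexCcw strictlyConvexCcw_A11 hq, leftTurning_of_strictlyConvexCcw strictlyConvexCcw_B11 hq,
      leftTurning_of_strictlyConvexCcw strictlyConvexCcw_A11 hq⟩) 0
  have hpos : 1 ≤ classVert (intCurve A11) (intCurve B11) (intCurve A11) 0 := by
    unfold classVert
    rw [← coe_classFin]
    have hne : (classFin (intCurve A11) (intCurve B11) (intCurve A11) (0 : ZMod 11)).Nonempty :=
      ⟨_, mem_classFin_of_sum_eq (a := intCurve A11) (b := intCurve B11) (c := intCurve A11)
        (x' := 0) (y' := 0) (z' := 0) (by simp)⟩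
    exact one_le_ncard_extremePoints hne
  omega

end TotalsLaw

end Summit.ValiantsHypothesis.ValiantsHypothesis.Theorems.NewtonUnitEquationsDissociatedUniform
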